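import Summits.MatrixMultiplication.OmegaCensus.STPPTricoloredToolkit
import Summits.MatrixMultiplication.OmegaCensus.STPPSmallPatternCyclicRaysT2

/-!
# ω-census, small STPP patterns: `(1,2,2)^k` in the squares `ℤ/n × ℤ/n` by the STPP × tricolored-sum-free product

HONEST FRAMING (pub-omega census; verbatim): lottery ticket; floor = certified bounds/negative ranges.
Census STRUCTURE bookkeeping of the STPP track (seat pub-omega-stpp-3, gen 26; STRUCTURE row B5, column `T2`), not progress on `ω`.

The prime-square seed types `ℤ/p × ℤ/p` of the `(1,2,2)^k` host laws are handled here ONCE AND FOR ALL `n`, with no search: the tree's product rule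
`isSTPP_prodTSF` (`STPPTricoloredProduct.lean`: an STPP family in `H₁` times a tricolored sum-free set of size `b` in `H₂` is an STPP family in
`H₁ × H₂` with the same size pattern and `b` times as many triples) applied to ENG2's cyclic `(1,2,2)^a` rays in `ℤ/n` and a tricolored sum-free set
of size `4` in `ℤ/n`, which exists for EVERY `n ≥ 9` (`exists_isTSF_four_zmod_of_le9`: `σ = τ = (0, 1, 3, 4)`, `υ = (0, −2, −6, −8)` — the defining
sums are integers of absolute value `≤ 8`, and `{0, 1, 3, 4}` has no nontrivial solution of `x + y = 2z`).

* `exists_isTSF_four_zmod_of_le9` — a 4-element tricolored sum-free set in `ℤ/n`, `n ≥ 9`;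
* `exists_isSTPP_cards_mul_of_tsf` — `(a,b,c)^N ⊆ H₁` and a `k`-element TSF in `H₂` give `(a,b,c)^{N·k} ⊆ H₁ × H₂` (existential packaging of
  `isSTPP_prodTSF` for an arbitrary size pattern);
* `exists_isSTPP_122pow8_zmod_sq` — **`(1,2,2)⁸ ⊆ ℤ/n × ℤ/n` for every `n ≥ 13`** (`(1,2,2)² ⊆ ℤ/n`, `n ≥ 12`, times the TSF of size `4`); likewise
  `(1,2,2)¹² ⊆ (ℤ/n)²` for `n ≥ 24`, `(1,2,2)¹⁶` for `n ≥ 33`, `(1,2,2)²⁰` for `n ≥ 48` (rays `k = 3, 4, 5`).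

References: H. Cohn, R. Kleinberg, B. Szegedy, C. Umans, FOCS 2005 (arXiv:math/0511460), Def. 5.1; J. Blasiak, T. Church, H. Cohn, J. Grochow,
E. Naslund, W. Sawin, C. Umans, Discrete Analysis 2017:3, Def. 3.1 (tricolored sum-free sets).
-/

open Literature.Computability.AlgebraicComplexity Literature.Combinatorics.Additive Finset

namespace Summit.MatrixMultiplication.OmegaCensus

/-! ## 1. A tricolored sum-free set of size four in every `ℤ/n`, `n ≥ 9` -/

/-- **A 4-element tricolored sum-free set in `ℤ/n` for every `n ≥ 9`:** `σ = τ = (0, 1, 3, 4)`, `υ = (0, −2, −6, −8)`.  The sums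
`σᵢ + τⱼ + υₗ` are integers in `[−8, 8]`, so they vanish mod `n ≥ 9` iff they vanish in `ℤ`, iff `i = j = l`.
[cite: BlasiakChurchCohnGrochowNaslundSawinUmans2017, Def. 3.1] -/
theorem exists_isTSF_four_zmod_of_le9 (n : ℕ) (hn : 9 ≤ n) : ∃ s t u : Fin 4 → ZMod n, IsTricoloredSumFree s t u := by
  have hiff : ∀ i j l : Fin 4, (![0, 1, 3, 4] : Fin 4 → ℤ) i + (![0, 1, 3, 4] : Fin 4 → ℤ) j + (![0, -2, -6, -8] : Fin 4 → ℤ) l = 0 ↔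
      (i = j ∧ j = l) := by decide
  have hbd : ∀ i j l : Fin 4, -9 < (![0, 1, 3, 4] : Fin 4 → ℤ) i + (![0, 1, 3, 4] : Fin 4 → ℤ) j + (![0, -2, -6, -8] : Fin 4 → ℤ) l ∧
      (![0, 1, 3, 4] : Fin 4 → ℤ) i + (![0, 1, 3, 4] : Fin 4 → ℤ) j + (![0, -2, -6, -8] : Fin 4 → ℤ) l < 9 := by decide
  refine ⟨fun i => (((![0, 1, 3, 4] : Fin 4 → ℤ) i : ℤ) : ZMod n), fun i => (((![0, 1, 3, 4] : Fin 4 → ℤ) i : ℤ) : ZMod n),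
    fun i => (((![0, -2, -6, -8] : Fin 4 → ℤ) i : ℤ) : ZMod n), fun i j l => ?_⟩
  rw [← Int.cast_add, ← Int.cast_add, ZMod.intCast_zmod_eq_zero_iff_dvd, ← hiff i j l]
  constructor
  · rintro ⟨d, hd⟩
    obtain ⟨h1, h2⟩ := hbd i j l
    have hq : (9 : ℤ) ≤ (n : ℤ) := by exact_mod_cast hn
    rcases lt_trichotomy d 0 with hd0 | rfl | hd0
    · nlinarith
    · simpa using hd
    · nlinarith
  · intro h
    rw [h]
    exact dvd_zero _

/-! ## 2. The product, existential form for an arbitrary size pattern -/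

/-- **`(a,b,c)^N ⊆ H₁` and a `k`-element tricolored sum-free set in `H₂` give `(a,b,c)^{N·k} ⊆ H₁ × H₂`** (existential packaging of
`isSTPP_prodTSF`). [cite: CohnKleinbergSzegedyUmans2005, Def. 5.1] -/
theorem exists_isSTPP_cards_mul_of_tsf {H₁ H₂ : Type*} [AddCommGroup H₁] [AddCommGroup H₂] {N k a b c : ℕ}
    (h1 : ∃ A B C : Fin N → Finset H₁, IsSTPP A B C ∧ ∀ i, (A i).card = a ∧ (B i).card = b ∧ (C i).card = c)
    {σ τ υ : Fin k → H₂} (hT : IsTricoloredSumFree σ τ υ) :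
    ∃ A B C : Fin (N * k) → Finset (H₁ × H₂), IsSTPP A B C ∧ ∀ m, (A m).card = a ∧ (B m).card = b ∧ (C m).card = c := by
  classical
  obtain ⟨A, B, C, hS, hc⟩ := h1
  refine ⟨_, _, _, isSTPP_prodTSF hS hT, fun m => ?_⟩
  simp only [card_product, card_singleton, mul_one]
  exact hc _

/-- **`(1,2,2)^a ⊆ ℤ/n` with `n ≥ 9` gives `(1,2,2)^{4a} ⊆ ℤ/n × ℤ/n`.** [cite: CohnKleinbergSzegedyUmans2005, Def. 5.1] -/
theorem exists_isSTPP_122pow_mul_four_zmod_sq {n a : ℕ} (hn : 9 ≤ n)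
    (h : ∃ A B C : Fin a → Finset (ZMod n), IsSTPP A B C ∧ ∀ i, (A i).card = 1 ∧ (B i).card = 2 ∧ (C i).card = 2) :
    ∃ A B C : Fin (a * 4) → Finset (ZMod n × ZMod n), IsSTPP A B C ∧ ∀ i, (A i).card = 1 ∧ (B i).card = 2 ∧ (C i).card = 2 := by
  obtain ⟨σ, τ, υ, hT⟩ := exists_isTSF_four_zmod_of_le9 n hn
  exact exists_isSTPP_cards_mul_of_tsf h hT

/-! ## 3. Instances: `(1,2,2)⁸`, `(1,2,2)¹²`, `(1,2,2)¹⁶`, `(1,2,2)²⁰` in `ℤ/n × ℤ/n` -/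

/-- **`(1,2,2)⁸ ⊆ ℤ/n × ℤ/n` for every `n ≥ 13`** (`(1,2,2)² ⊆ ℤ/n` for `n ≥ 12`, times the TSF of size `4`); in particular every prime square
`(ℤ/p)²`, `p ≥ 13`, hosts `(1,2,2)⁸` (the prime-square seeds of the `(1,2,2)⁷` and `(1,2,2)⁸` host laws). [cite: CohnKleinbergSzegedyUmans2005, Def. 5.1] -/
theorem exists_isSTPP_122pow8_zmod_sq (n : ℕ) (hn : 13 ≤ n) :
    ∃ A B C : Fin 8 → Finset (ZMod n × ZMod n), IsSTPP A B C ∧ ∀ i, (A i).card = 1 ∧ (B i).card = 2 ∧ (C i).card = 2 :=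
  exists_isSTPP_122pow_mul_four_zmod_sq (a := 2) (by omega) (exists_isSTPP_122pow2_zmod_of_le12 n (by omega))

/-- `(1,2,2)¹² ⊆ ℤ/n × ℤ/n` for every `n ≥ 24`. [cite: CohnKleinbergSzegedyUmans2005, Def. 5.1] -/
theorem exists_isSTPP_122pow12_zmod_sq (n : ℕ) (hn : 24 ≤ n) :
    ∃ A B C : Fin 12 → Finset (ZMod n × ZMod n), IsSTPP A B C ∧ ∀ i, (A i).card = 1 ∧ (B i).card = 2 ∧ (C i).card = 2 :=
  exists_isSTPP_122pow_mul_four_zmod_sq (a := 3) (by omega) (exists_isSTPP_122pow3_zmod_of_le n hn)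

/-- `(1,2,2)¹⁶ ⊆ ℤ/n × ℤ/n` for every `n ≥ 33`. [cite: CohnKleinbergSzegedyUmans2005, Def. 5.1] -/
theorem exists_isSTPP_122pow16_zmod_sq (n : ℕ) (hn : 33 ≤ n) :
    ∃ A B C : Fin 16 → Finset (ZMod n × ZMod n), IsSTPP A B C ∧ ∀ i, (A i).card = 1 ∧ (B i).card = 2 ∧ (C i).card = 2 :=
  exists_isSTPP_122pow_mul_four_zmod_sq (a := 4) (by omega) (exists_isSTPP_122pow4_zmod_of_le n hn)

/-- `(1,2,2)²⁰ ⊆ ℤ/n × ℤ/n` for every `n ≥ 48`. [cite: CohnKleinbergSzegedyUmans2005, Def. 5.1] -/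
theorem exists_isSTPP_122pow20_zmod_sq (n : ℕ) (hn : 48 ≤ n) :
    ∃ A B C : Fin 20 → Finset (ZMod n × ZMod n), IsSTPP A B C ∧ ∀ i, (A i).card = 1 ∧ (B i).card = 2 ∧ (C i).card = 2 :=
  exists_isSTPP_122pow_mul_four_zmod_sq (a := 5) (by omega) (exists_isSTPP_122pow5_zmod_of_le n hn)

/-! ## 4. Larger tricolored sum-free sets in `ℤ/n`: the base-3 digit sets (appended) -/

/-- **An 8-element tricolored sum-free set in `ℤ/n` for every `n ≥ 27`:** `σ = τ =` the numbers `< 27` with base-3 digits in `{0, 1}`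
(`0, 1, 3, 4, 9, 10, 12, 13`), `υ = −2σ`.  The sums `σᵢ + τⱼ + υₗ` are integers in `[−26, 26]`; they vanish in `ℤ` iff `i = j = l` (no carries in base 3).
[cite: BlasiakChurchCohnGrochowNaslundSawinUmans2017, Def. 3.1] -/
theorem exists_isTSF_eight_zmod_of_le27 (n : ℕ) (hn : 27 ≤ n) : ∃ s t u : Fin 8 → ZMod n, IsTricoloredSumFree s t u := by
  have hiff : ∀ i j l : Fin 8, (![0, 1, 3, 4, 9, 10, 12, 13] : Fin 8 → ℤ) i + (![0, 1, 3, 4, 9, 10, 12, 13] : Fin 8 → ℤ) j + (![0, -2, -6, -8, -18, -20, -24, -26] : Fin 8 → ℤ) l = 0 ↔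
      (i = j ∧ j = l) := by decide
  have hbd : ∀ i j l : Fin 8, -27 < (![0, 1, 3, 4, 9, 10, 12, 13] : Fin 8 → ℤ) i + (![0, 1, 3, 4, 9, 10, 12, 13] : Fin 8 → ℤ) j + (![0, -2, -6, -8, -18, -20, -24, -26] : Fin 8 → ℤ) l ∧
      (![0, 1, 3, 4, 9, 10, 12, 13] : Fin 8 → ℤ) i + (![0, 1, 3, 4, 9, 10, 12, 13] : Fin 8 → ℤ) j + (![0, -2, -6, -8, -18, -20, -24, -26] : Fin 8 → ℤ) l < 27 := by decide
  refine ⟨fun i => (((![0, 1, 3, 4, 9, 10, 12, 13] : Fin 8 → ℤ) i : ℤ) : ZMod n), fun i => (((![0, 1, 3, 4, 9, 10, 12, 13] : Fin 8 → ℤ) i : ℤ) : ZMod n),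
    fun i => (((![0, -2, -6, -8, -18, -20, -24, -26] : Fin 8 → ℤ) i : ℤ) : ZMod n), fun i j l => ?_⟩
  rw [← Int.cast_add, ← Int.cast_add, ZMod.intCast_zmod_eq_zero_iff_dvd, ← hiff i j l]
  constructor
  · rintro ⟨d, hd⟩
    obtain ⟨h1, h2⟩ := hbd i j l
    have hq : (27 : ℤ) ≤ (n : ℤ) := by exact_mod_cast hn
    rcases lt_trichotomy d 0 with hd0 | rfl | hd0
    · nlinarith
    · simpa using hd
    · nlinarith
  · intro h
    rw [h]
    exact dvd_zero _

/-- **A 16-element tricolored sum-free set in `ℤ/n` for every `n ≥ 81`** (numbers `< 81` with base-3 digits in `{0, 1}`, `υ = −2σ`; sums in `[−80, 80]`).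
[cite: BlasiakChurchCohnGrochowNaslundSawinUmans2017, Def. 3.1] -/
theorem exists_isTSF_sixteen_zmod_of_le81 (n : ℕ) (hn : 81 ≤ n) : ∃ s t u : Fin 16 → ZMod n, IsTricoloredSumFree s t u := by
  have hiff : ∀ i j l : Fin 16, (![0, 1, 3, 4, 9, 10, 12, 13, 27, 28, 30, 31, 36, 37, 39, 40] : Fin 16 → ℤ) i + (![0, 1, 3, 4, 9, 10, 12, 13, 27, 28, 30, 31, 36, 37, 39, 40] : Fin 16 → ℤ) j +
      (![0, -2, -6, -8, -18, -20, -24, -26, -54, -56, -60, -62, -72, -74, -78, -80] : Fin 16 → ℤ) l = 0 ↔ (i = j ∧ j = l) := by decide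
  have hbd : ∀ i j l : Fin 16, -81 < (![0, 1, 3, 4, 9, 10, 12, 13, 27, 28, 30, 31, 36, 37, 39, 40] : Fin 16 → ℤ) i + (![0, 1, 3, 4, 9, 10, 12, 13, 27, 28, 30, 31, 36, 37, 39, 40] : Fin 16 → ℤ) j +
      (![0, -2, -6, -8, -18, -20, -24, -26, -54, -56, -60, -62, -72, -74, -78, -80] : Fin 16 → ℤ) l ∧ (![0, 1, 3, 4, 9, 10, 12, 13, 27, 28, 30, 31, 36, 37, 39, 40] : Fin 16 → ℤ) i + (![0, 1, 3, 4, 9, 10, 12, 13, 27, 28, 30, 31, 36, 37, 39, 40] : Fin 16 → ℤ) j +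
      (![0, -2, -6, -8, -18, -20, -24, -26, -54, -56, -60, -62, -72, -74, -78, -80] : Fin 16 → ℤ) l < 81 := by decide
  refine ⟨fun i => (((![0, 1, 3, 4, 9, 10, 12, 13, 27, 28, 30, 31, 36, 37, 39, 40] : Fin 16 → ℤ) i : ℤ) : ZMod n),
    fun i => (((![0, 1, 3, 4, 9, 10, 12, 13, 27, 28, 30, 31, 36, 37, 39, 40] : Fin 16 → ℤ) i : ℤ) : ZMod n),
    fun i => (((![0, -2, -6, -8, -18, -20, -24, -26, -54, -56, -60, -62, -72, -74, -78, -80] : Fin 16 → ℤ) i : ℤ) : ZMod n), fun i j l => ?_⟩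
  rw [← Int.cast_add, ← Int.cast_add, ZMod.intCast_zmod_eq_zero_iff_dvd, ← hiff i j l]
  constructor
  · rintro ⟨d, hd⟩
    obtain ⟨h1, h2⟩ := hbd i j l
    have hq : (81 : ℤ) ≤ (n : ℤ) := by exact_mod_cast hn
    rcases lt_trichotomy d 0 with hd0 | rfl | hd0
    · nlinarith
    · simpa using hd
    · nlinarith
  · intro h
    rw [h]
    exact dvd_zero _

/-- `(1,2,2)^a ⊆ ℤ/n` with `n ≥ 27` gives `(1,2,2)^{8a} ⊆ ℤ/n × ℤ/n`. [cite: CohnKleinbergSzegedyUmans2005, Def. 5.1] -/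
theorem exists_isSTPP_122pow_mul_eight_zmod_sq {n a : ℕ} (hn : 27 ≤ n)
    (h : ∃ A B C : Fin a → Finset (ZMod n), IsSTPP A B C ∧ ∀ i, (A i).card = 1 ∧ (B i).card = 2 ∧ (C i).card = 2) :
    ∃ A B C : Fin (a * 8) → Finset (ZMod n × ZMod n), IsSTPP A B C ∧ ∀ i, (A i).card = 1 ∧ (B i).card = 2 ∧ (C i).card = 2 := by
  obtain ⟨σ, τ, υ, hT⟩ := exists_isTSF_eight_zmod_of_le27 n hn
  exact exists_isSTPP_cards_mul_of_tsf h hT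

/-- `(1,2,2)^a ⊆ ℤ/n` with `n ≥ 81` gives `(1,2,2)^{16a} ⊆ ℤ/n × ℤ/n`. [cite: CohnKleinbergSzegedyUmans2005, Def. 5.1] -/
theorem exists_isSTPP_122pow_mul_sixteen_zmod_sq {n a : ℕ} (hn : 81 ≤ n)
    (h : ∃ A B C : Fin a → Finset (ZMod n), IsSTPP A B C ∧ ∀ i, (A i).card = 1 ∧ (B i).card = 2 ∧ (C i).card = 2) :
    ∃ A B C : Fin (a * 16) → Finset (ZMod n × ZMod n), IsSTPP A B C ∧ ∀ i, (A i).card = 1 ∧ (B i).card = 2 ∧ (C i).card = 2 := by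
  obtain ⟨σ, τ, υ, hT⟩ := exists_isTSF_sixteen_zmod_of_le81 n hn
  exact exists_isSTPP_cards_mul_of_tsf h hT

/-- **`(1,2,2)²⁴ ⊆ ℤ/n × ℤ/n` for every `n ≥ 27`** (`(1,2,2)³ ⊆ ℤ/n`, `n ≥ 24`, times the TSF of size `8`): the prime-square seeds `(ℤ/p)²`, `p ≥ 29`, of every
`(1,2,2)^k` law with `k ≤ 24`. [cite: CohnKleinbergSzegedyUmans2005, Def. 5.1] -/
theorem exists_isSTPP_122pow24_zmod_sq (n : ℕ) (hn : 27 ≤ n) :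
    ∃ A B C : Fin 24 → Finset (ZMod n × ZMod n), IsSTPP A B C ∧ ∀ i, (A i).card = 1 ∧ (B i).card = 2 ∧ (C i).card = 2 :=
  exists_isSTPP_122pow_mul_eight_zmod_sq (a := 3) hn (exists_isSTPP_122pow3_zmod_of_le n (by omega))

/-- `(1,2,2)⁴⁰ ⊆ ℤ/n × ℤ/n` for every `n ≥ 48` (`(1,2,2)⁵ ⊆ ℤ/n` times the TSF of size `8`). [cite: CohnKleinbergSzegedyUmans2005, Def. 5.1] -/
theorem exists_isSTPP_122pow40_zmod_sq (n : ℕ) (hn : 48 ≤ n) :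
    ∃ A B C : Fin 40 → Finset (ZMod n × ZMod n), IsSTPP A B C ∧ ∀ i, (A i).card = 1 ∧ (B i).card = 2 ∧ (C i).card = 2 :=
  exists_isSTPP_122pow_mul_eight_zmod_sq (a := 5) (by omega) (exists_isSTPP_122pow5_zmod_of_le n hn)

/-- **`(1,2,2)⁸⁰ ⊆ ℤ/n × ℤ/n` for every `n ≥ 81`** (`(1,2,2)⁵ ⊆ ℤ/n` times the TSF of size `16`): prime-square seeds `(ℤ/p)²`, `p ≥ 83`, of every
`(1,2,2)^k` law with `k ≤ 80`. [cite: CohnKleinbergSzegedyUmans2005, Def. 5.1] -/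
theorem exists_isSTPP_122pow80_zmod_sq (n : ℕ) (hn : 81 ≤ n) :
    ∃ A B C : Fin 80 → Finset (ZMod n × ZMod n), IsSTPP A B C ∧ ∀ i, (A i).card = 1 ∧ (B i).card = 2 ∧ (C i).card = 2 :=
  exists_isSTPP_122pow_mul_sixteen_zmod_sq (a := 5) hn (exists_isSTPP_122pow5_zmod_of_le n (by omega))

end Summit.MatrixMultiplication.OmegaCensus
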